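import Literature.NumberTheory.GaloisRepresentations.PicardLambdaAdicRepChebotarev
import Literature.NumberTheory.GaloisRepresentations.SuperellipticPointCount
import Literature.NumberTheory.DiophantineGeometry.FunctionFieldHasseWeilProofs
import Literature.NumberTheory.DiophantineGeometry.FunctionFieldSchmidtDegreeOneConsequencesProofs
import HarnessLib

/-!
# Galois representations of Picard curves: the last geometric input from the Hasse–Weil theorem

Toward `picardCurve_exists_lambdaAdicRep` (Upton 2009, Thm. 2.1 / §4: the `(1 - ω)`-adic representations
of `Γ_{ℚ(ω)}` attached to the Picard curves `C_f : y³ = f(x)`).  The conditional theorems of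
`PicardLambdaAdicRepChebotarev` derive the full statement from the good-reduction datum (`hX2`,
Serre–Tate), the twisted Lefschetz trace formula (`hX3`, Weil/Milne) and ONE residual geometric input
(`hX0`): the Tate module `T₃ Pic(C_{f,K̄})` is nonzero — a shadow of `dim J(C_f) = 3` which the Chebotarev
congruences cannot see for the quartics `f` with a root in `ℚ(ω)`.  This file REMOVES `hX0`, replacing it by
the **Hasse–Weil theorem for function fields over finite fields, which is PROVED in the tree**
(`AlgFunctionField.hasseWeil_holds`, Bombieri–Stepanov; `lSeries_eq_polynomial_holds`, F. K. Schmidt):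

* **The argument** (`SuperellipticFunctionField.nontrivial_tateModule_superellipticPic_of_lefschetz`).
  Let `k = 𝔽_q ∋ ζ₃` (`3 ∤ q`), `Ω ⊇ k` algebraically closed and algebraic over `k`, `f ∈ k[X]` a separable
  quartic, and suppose `T₃ Pic(C_{f,Ω}) = 0`.  For every `r ≥ 1` realise `𝔽_{q^r}` as `K' = k[X]/(ψ)`,
  `ψ` irreducible of degree `r`, embedded in `Ω` (`IsAlgClosed.lift`); the curve over `Ω` is the same
  whether `f` is first pushed to `K'` or not (`superellipticPoly_map_eq`), so its Tate module vanishes at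
  level `K'` too (`subsingleton_tateModule_superellipticPic_iff`) and the twisted Lefschetz formula `hX3`
  at level `K'` (Frobenius `x ↦ x^{q^r}`, trivial twist) reads `#Fix(Frob_{q^r}) = q^r + 1` on the places
  of `Ω(C_f)`.  By the tree's count of fixed places (`card_fixedPlaces_frobenius_deck`) and Euler's
  criterion (`card_affinePoints_eq_euler`) this number is `1 + #{(a, b) ∈ 𝔽_{q^r}² : b³ = f(a)}`, which
  in turn is `N_r` of the function field `F = k(C_f)` in the sense of Stichtenoth (5.40)
  (`pointCount_natDegree_superelliptic`: the constant field extension `F𝔽_{q^r} = F[X]/(ψ)` of the tree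
  is `K'`-isomorphic to `K'(C_f)`, `nonempty_algEquiv_model`, its rational places number `N_r(F)` by the
  tree's double count `mul_sum_natCard_fixed_eq_card_mul_pointCount` and Lemma 5.1.9 (d)
  `isRational_of_restrict_eq`, and `N_1(K'(C_f)) = #{b³ = f(a)} + 1` is `pointCount_one_superelliptic`).
  So `N_r(F) = q^r + 1` for all `r ≥ 1`, i.e. `∑ᵢ αᵢ^r = 0` for the `2g` reciprocal roots of `L_F`, all of
  absolute value `√q` (Hasse–Weil, `exists_pointCount_eq_of_facts`); by Artin's independence of the
  characters `r ↦ s^r` this forces `2g = 0` (`card_eq_zero_of_forall_sum_pow_eq_zero`) — but `g ≥ 1`: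
  `ℒ(∞_C) = k` for `y³ = f(x)` (eigen-decomposition under `y ↦ ζ₃ y`; a monomial `r(x) yʲ` with at most a
  simple pole at `∞_C` is constant), so Riemann's inequality at the rational place `∞_C` gives
  `2 - g ≤ ℓ(∞_C) = 1` (`one_le_genus_superelliptic_three`).
* **Consequence** (`picardCurve_exists_lambdaAdicRep_of_goodReduction_lefschetz`): ALL clauses of
  `picardCurve_exists_lambdaAdicRep`, for EVERY separable quartic `f ∈ ℤ[X]`, from `hX2` + `hX3` alone
  (`picard_nontrivial_tateModule`: at a good prime the reduction map of `hX2` is an isomorphism of Tate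
  modules, and the special fibre is nonzero by the argument above).

All statements are theorems; no definitions and no named facts are introduced; `hX2`, `hX3` are the
hypotheses of `PicardLambdaAdicRepChebotarev`, verbatim.

## References
* C. Upton, *Galois representations attached to Picard curves*, J. Algebra 322 (2009), §§2–4. [Upton2009]
* H. Stichtenoth, *Algebraic Function Fields and Codes*, 2nd ed., GTM 254 (2009), Lemma 5.1.9, eq. (5.40),
  Thm. 5.1.15, Cor. 5.1.16, Thm. 5.2.1 (Hasse–Weil), Thm. 1.4.17 (Riemann), Prop. 3.6.1, Prop. 3.1.4. [Stichtenoth2009]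
* A. Weil, *Sur les courbes algébriques et les variétés qui s'en déduisent* (1948). [Weil1948]
* E. Bombieri, *Counting points on curves over finite fields (d'après S. A. Stepanov)*, Sém. Bourbaki 430 (1973).
* J. S. Milne, *Jacobian varieties*, in: Arithmetic Geometry (1986), §11 Prop. 11.2. [Milne1986JacobianVarieties]
* J.-P. Serre, J. Tate, *Good reduction of abelian varieties*, Ann. of Math. 88 (1968), §1 Thm. 1. [SerreTate1968GoodReduction]
* E. F. Schaefer, *Computing a Selmer group of a Jacobian using functions on the curve*, Math. Ann. 310 (1998), §3. [Schaefer1998]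
-/

noncomputable section

open Polynomial
open scoped Classical

namespace Literature.NumberTheory.GaloisRepresentations

open Literature.NumberTheory.EllipticCurves Literature.NumberTheory.DiophantineGeometry
  Literature.NumberTheory.DiophantineGeometry.AlgFunctionField SuperellipticFunctionField Field IsDedekindDomain
open scoped NumberField Pointwise

attribute [local instance] Ideal.Quotient.field
attribute [local instance] Finsupp.comapSMul Finsupp.comapMulAction Finsupp.comapDistribMulAction

set_option synthInstance.maxHeartbeats 160000

universe u v

/-! ### The level change `k ↦ K' = 𝔽_{q^r}` does not change the curve over `Ω` -/

section LevelChange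

variable {k : Type u} [Field k] {K' : Type u} [Field K'] [Algebra k K'] {Ω : Type v} [Field Ω]
  [Algebra k Ω] [Algebra K' Ω] [IsScalarTower k K' Ω]

/-- `Y^p - f(x)` over `Ω` is the same polynomial whether `f ∈ k[X]` is first pushed to an intermediate
field `K'` or not. [folklore] -/
theorem superellipticPoly_map_eq (p : ℕ) (f : k[X]) :
    superellipticPoly K' Ω p (f.map (algebraMap k K')) = superellipticPoly k Ω p f := by
  simp only [superellipticPoly, Polynomial.map_map, ← IsScalarTower.algebraMap_eq]

end LevelChange

section Transport

variable {K₁ : Type u} [Field K₁] {K₂ : Type u} [Field K₂] {Ω : Type v} [Field Ω] [Algebra K₁ Ω] [Algebra K₂ Ω]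
  {p : ℕ} {f₁ : K₁[X]} {f₂ : K₂[X]}

/-- **Transport of `T_ℓ Pic = 0` along equal plane models.**  If `Y^p - f₁(x)` and `Y^p - f₂(x)` are the
same polynomial over `Ω(x)` (e.g. `f₂ = f₁` pushed to an intermediate field), the two divisor class
groups are literally the same group, so one Tate module vanishes iff the other does. [folklore] -/
theorem subsingleton_tateModule_superellipticPic_iff
    [i₁ : Fact (Irreducible (superellipticPoly K₁ Ω p f₁))] [i₂ : Fact (Irreducible (superellipticPoly K₂ Ω p f₂))]
    (h : superellipticPoly K₁ Ω p f₁ = superellipticPoly K₂ Ω p f₂) (ℓ : ℕ) :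
    Subsingleton (TateModule (SuperellipticPic K₁ Ω p f₁) ℓ) ↔
      Subsingleton (TateModule (SuperellipticPic K₂ Ω p f₂) ℓ) := by
  have key : ∀ (P₁ P₂ : (RatFunc Ω)[X]) (j₁ : Fact (Irreducible P₁)) (j₂ : Fact (Irreducible P₂)), P₁ = P₂ →
      (Subsingleton (TateModule (DivisorClass Ω (AdjoinRoot P₁)) ℓ) ↔
        Subsingleton (TateModule (DivisorClass Ω (AdjoinRoot P₂)) ℓ)) := by
    rintro P₁ P₂ j₁ j₂ rfl
    exact Iff.rfl
  exact key _ _ i₁ i₂ h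

end Transport

/-! ### `V_ℓ = 0` when `T_ℓ = 0`, and then every trace vanishes -/

section TraceZero

variable {A : Type u} [AddCommGroup A] {ℓ : ℕ} [Fact ℓ.Prime]

/-- If `T_ℓ A = 0` then `V_ℓ A = ℚ_ℓ ⊗ T_ℓ A = 0`. [folklore] -/
theorem subsingleton_rationalTateModule [Subsingleton (TateModule A ℓ)] : Subsingleton (RationalTateModule A ℓ) := by
  have : Subsingleton (TensorProduct ℤ_[ℓ] ℚ_[ℓ] (TateModule A ℓ)) := by
    refine ⟨fun x y => ?_⟩
    have h0 : ∀ z : TensorProduct ℤ_[ℓ] ℚ_[ℓ] (TateModule A ℓ), z = 0 := fun z => by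
      induction z using TensorProduct.induction_on with
      | zero => rfl
      | tmul c t => rw [Subsingleton.elim t 0, TensorProduct.tmul_zero]
      | add a b ha hb => rw [ha, hb, add_zero]
    rw [h0 x, h0 y]
  exact this

/-- On the zero module every endomorphism has trace `0`. [folklore] -/
theorem trace_eq_zero_of_subsingleton {R M : Type*} [CommRing R] [AddCommGroup M] [Module R M] [Subsingleton M]
    (g : M →ₗ[R] M) : LinearMap.trace R M g = 0 := by
  have : g = 0 := Subsingleton.elim _ _
  rw [this, map_zero]

end TraceZero

/-! ### The `q^r`-Frobenius as an automorphism over the level field `K'` -/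

section FrobPow

variable {k : Type u} [Field k] [Fintype k] {Ω : Type v} [Field Ω] [Algebra k Ω]

/-- `φ^r x = x^{q^r}` for a `q`-Frobenius `φ`. [folklore] -/
theorem algEquiv_pow_apply_eq_pow_card_pow (φ : Ω ≃ₐ[k] Ω) (hφ : ∀ x : Ω, φ x = x ^ Fintype.card k) (r : ℕ) (x : Ω) :
    (φ ^ r) x = x ^ Fintype.card k ^ r := by
  induction r generalizing x with
  | zero => simp
  | succ r ih => rw [pow_succ, AlgEquiv.mul_apply, hφ, ih, ← pow_mul, ← pow_succ']

variable {K' : Type*} [Field K'] [Fintype K'] [Algebra K' Ω]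

/-- **The `q^r`-Frobenius is `K'`-linear for `#K' = q^r`**: the automorphism `φ^r` of `Ω` fixes the image
of `K'` pointwise (`c^{#K'} = c`), so it is an automorphism of `Ω` over `K'`, and `φ^r x = x^{#K'}`. [folklore] -/
theorem exists_algEquiv_apply_eq_pow_card (φ : Ω ≃ₐ[k] Ω) (hφ : ∀ x : Ω, φ x = x ^ Fintype.card k) (r : ℕ)
    (hK' : Fintype.card K' = Fintype.card k ^ r) :
    ∃ φ' : Ω ≃ₐ[K'] Ω, ∀ x : Ω, φ' x = x ^ Fintype.card K' := by
  refine ⟨AlgEquiv.ofRingEquiv (f := ((φ ^ r : Ω ≃ₐ[k] Ω) : Ω ≃+* Ω)) fun c => ?_, fun x => ?_⟩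
  · change (φ ^ r) (algebraMap K' Ω c) = algebraMap K' Ω c
    rw [algEquiv_pow_apply_eq_pow_card_pow φ hφ, ← hK', ← map_pow, FiniteField.pow_card]
  · change (φ ^ r) x = x ^ Fintype.card K'
    rw [hK']
    exact algEquiv_pow_apply_eq_pow_card_pow φ hφ r x

end FrobPow

/-! ### Nonzero complex numbers cannot have all power sums zero (Artin) -/

section PowerSums

/-- **Vanishing power sums force an empty family** (Newton / Artin): if `α₁, …, α_n ∈ ℂ` are all nonzero and
`∑ᵢ αᵢ^r = 0` for every `r ≥ 1`, then `n = 0`.  Proof: group equal values, `∑_s c_s s^r = 0` with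
multiplicities `c_s ≥ 1`; the characters `r ↦ s^r` of `ℕ` are linearly independent (Artin, Mathlib
`linearIndependent_monoidHom`), and `∑_s (c_s s) · (r ↦ s^r) = 0`, so `c_s s = 0`, `s = 0`. [folklore] -/
theorem card_eq_zero_of_forall_sum_pow_eq_zero {n : ℕ} (α : Fin n → ℂ) (hα : ∀ i, α i ≠ 0)
    (h : ∀ r : ℕ, 0 < r → ∑ i, α i ^ r = 0) : n = 0 := by
  classical
  by_contra hn
  obtain ⟨i₀⟩ : Nonempty (Fin n) := Fin.pos_iff_nonempty.mp (Nat.pos_of_ne_zero hn)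
  -- distinct values and multiplicities
  set S : Finset ℂ := Finset.univ.image α with hS
  set c : ℂ → ℕ := fun s => (Finset.univ.filter fun i => α i = s).card with hc
  have hsum : ∀ r : ℕ, 0 < r → ∑ s ∈ S, (c s : ℂ) * s ^ r = 0 := by
    intro r hr
    rw [← h r hr, ← Finset.sum_fiberwise_of_maps_to (g := α) (s := Finset.univ) (t := S)
      (fun i _ => Finset.mem_image_of_mem α (Finset.mem_univ i))]
    refine Finset.sum_congr rfl fun s _ => ?_
    rw [Finset.sum_congr rfl (fun i (hi : i ∈ Finset.univ.filter fun i => α i = s) => by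
      rw [(Finset.mem_filter.1 hi).2]), Finset.sum_const, nsmul_eq_mul]
  -- the characters `r ↦ s^r`
  let χ : ℂ → (Multiplicative ℕ →* ℂ) := fun s => powersHom ℂ s
  have hχ : Function.Injective χ := fun s t hst => by
    have := DFunLike.congr_fun hst (Multiplicative.ofAdd 1)
    simpa [χ, powersHom_apply] using this
  have hli := (linearIndependent_monoidHom (Multiplicative ℕ) ℂ).comp χ hχ
  -- the vanishing combination
  have hcomb : ∑ s ∈ S, ((c s : ℂ) * s) • ((χ s : Multiplicative ℕ →* ℂ) : Multiplicative ℕ → ℂ) = 0 := by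
    ext r
    rw [Finset.sum_apply, Pi.zero_apply]
    have := hsum (Multiplicative.toAdd r + 1) (Nat.succ_pos _)
    rw [← this]
    refine Finset.sum_congr rfl fun s _ => ?_
    simp only [Pi.smul_apply, smul_eq_mul, χ, powersHom_apply]
    rw [show (s ^ (Multiplicative.toAdd r) : ℂ) = s ^ (Multiplicative.toAdd r) from rfl]
    ring
  have hzero := linearIndependent_iff'.1 hli S (fun s => (c s : ℂ) * s) hcomb
  -- `α i₀` is one of the values, with positive multiplicity
  have hmem : α i₀ ∈ S := Finset.mem_image_of_mem α (Finset.mem_univ i₀)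
  have hc0 : (c (α i₀) : ℂ) ≠ 0 := by
    rw [Nat.cast_ne_zero, hc]
    exact Finset.card_ne_zero.2 ⟨i₀, Finset.mem_filter.2 ⟨Finset.mem_univ _, rfl⟩⟩
  have := hzero (α i₀) hmem
  rcases mul_eq_zero.1 this with h0 | h0
  · exact hc0 h0
  · exact hα i₀ h0

end PowerSums


/-! ### The constant field extension `k(C_f)𝔽_{q^r}` is `𝔽_{q^r}(C_f)`, and `N_r(k(C_f))` is the naive count -/

/-- `liftRingHom` on (the image of) a polynomial. [folklore] -/
theorem _root_.RatFunc.liftRingHom_algebraMap_polynomial {K L : Type*} [Field K] [Field L] (φ : K[X] →+* L)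
    (hφ : nonZeroDivisors K[X] ≤ (nonZeroDivisors L).comap φ) (p : K[X]) :
    RatFunc.liftRingHom φ hφ (algebraMap K[X] (RatFunc K) p) = φ p := by
  have := RatFunc.liftRingHom_apply_div φ hφ p 1
  rwa [map_one, map_one, div_one, div_one] at this

/-- `eval₂` of `Y^m - f(x)` along a ring homomorphism of `L(x)`. [folklore] -/
theorem eval₂_superellipticPoly_ringHom {K L S : Type*} [Field K] [Field L] [Algebra K L] [CommRing S]
    (m : ℕ) (f : K[X]) (i : RatFunc L →+* S) (y : S) :
    (superellipticPoly K L m f).eval₂ i y = y ^ m - i (algebraMap L[X] (RatFunc L) (f.map (algebraMap K L))) := by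
  simp only [superellipticPoly, eval₂_sub, eval₂_X_pow, eval₂_C]

namespace SuperellipticFunctionField

section Model

variable {k : Type u} [Field k] {p : ℕ} {f : k[X]}
variable [Fact (Irreducible (superellipticPoly k k p f))]
variable (ψ : k[X]) [hψ : Fact (Irreducible ψ)]
variable [Fact (Irreducible (superellipticPoly (AdjoinRoot ψ) (AdjoinRoot ψ) p (f.map (algebraMap k (AdjoinRoot ψ)))))]

omit [Fact (Irreducible (superellipticPoly k k p f))] in
/-- Notation: `F = k(C_f)`, `K' = k[X]/(ψ)`, `L' = K'(C_f)`, `F' = F[X]/(ψ)`.  The ring homomorphism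
`k[X] → K'(C_f)`, `g ↦ g(x)`, is injective. [folklore] -/
theorem algebraMap_comp_mapRingHom_injective :
    Function.Injective ((algebraMap (AdjoinRoot ψ)[X]
      (SuperellipticFunctionField (AdjoinRoot ψ) (AdjoinRoot ψ) p (f.map (algebraMap k (AdjoinRoot ψ))))).comp
        (mapRingHom (algebraMap k (AdjoinRoot ψ)))) :=
  (algebraMap_polynomial_injective (AdjoinRoot ψ) (AdjoinRoot ψ) p _).comp
    (Polynomial.map_injective _ (algebraMap k (AdjoinRoot ψ)).injective)

/-- **`k(C_f) → K'(C_f)`**, the change of constants `k → K' = k[X]/(ψ)` on the function field of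
`C_f : y^p = f(x)` (`x ↦ x`, `y ↦ y`). [folklore] -/
theorem exists_ringHom_base :
    ∃ i : SuperellipticFunctionField k k p f →+*
        SuperellipticFunctionField (AdjoinRoot ψ) (AdjoinRoot ψ) p (f.map (algebraMap k (AdjoinRoot ψ))),
      i.comp (algebraMap k[X] (SuperellipticFunctionField k k p f)) =
          (algebraMap (AdjoinRoot ψ)[X] _).comp (mapRingHom (algebraMap k (AdjoinRoot ψ))) ∧
      i (genY k k p f) = genY (AdjoinRoot ψ) (AdjoinRoot ψ) p (f.map (algebraMap k (AdjoinRoot ψ))) := by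
  set K' := AdjoinRoot ψ
  set L' := SuperellipticFunctionField K' K' p (f.map (algebraMap k K'))
  set ι₁ : k[X] →+* L' := (algebraMap K'[X] L').comp (mapRingHom (algebraMap k K')) with hι₁
  have hι₁inj : Function.Injective ι₁ := algebraMap_comp_mapRingHom_injective ψ
  set i₀ : RatFunc k →+* L' :=
    RatFunc.liftRingHom ι₁ (nonZeroDivisors_le_comap_nonZeroDivisors_of_injective ι₁ hι₁inj) with hi₀
  have hi₀ : ∀ g : k[X], i₀ (algebraMap k[X] (RatFunc k) g) = ι₁ g := fun g =>
    RatFunc.liftRingHom_algebraMap_polynomial ι₁ _ g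
  have hroot : (superellipticPoly k k p f).eval₂ i₀ (genY K' K' p (f.map (algebraMap k K'))) = 0 := by
    rw [eval₂_superellipticPoly_ringHom, hi₀, genY_pow, sub_eq_zero, hι₁]
    simp only [RingHom.comp_apply, coe_mapRingHom, Polynomial.map_map, Algebra.algebraMap_self,
      RingHomCompTriple.comp_eq]
    rfl
  have hof : ∀ r : RatFunc k, AdjoinRoot.lift i₀ (genY K' K' p (f.map (algebraMap k K'))) hroot
      (algebraMap (RatFunc k) (SuperellipticFunctionField k k p f) r) = i₀ r := fun r => AdjoinRoot.lift_of hroot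
  refine ⟨AdjoinRoot.lift i₀ (genY K' K' p (f.map (algebraMap k K'))) hroot, ?_, ?_⟩
  · have h1 : ∀ g : k[X], AdjoinRoot.lift i₀ (genY K' K' p (f.map (algebraMap k K'))) hroot
        (algebraMap k[X] (SuperellipticFunctionField k k p f) g) = ι₁ g := fun g => by
      rw [IsScalarTower.algebraMap_apply k[X] (RatFunc k) (SuperellipticFunctionField k k p f), hof, hi₀]
    exact RingHom.ext fun g => h1 g
  · exact AdjoinRoot.lift_root hroot

/-- **The constant field extension of `k(C_f)` by `K' = k[X]/(ψ)` is `K'(C_f)`**: the model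
`F' = F[X]/(ψ)` (`F = k(C_f)`) of `FunctionFieldConstantExtension` is `K'`-isomorphic to the function field
of the same curve over `K'` (`α ↦ α`, `x ↦ x`, `y ↦ y`; the inverse exists because `x` stays transcendental
over the algebraic extension `K'` of `k`). [cite: Stichtenoth2009, Prop. 3.6.1] -/
theorem nonempty_algEquiv_model [IsIntegrallyClosedIn k (SuperellipticFunctionField k k p f)] :
    Nonempty (AdjoinRoot (ψ.map (algebraMap k (SuperellipticFunctionField k k p f))) ≃ₐ[AdjoinRoot ψ]
      SuperellipticFunctionField (AdjoinRoot ψ) (AdjoinRoot ψ) p (f.map (algebraMap k (AdjoinRoot ψ)))) := by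
  set K' := AdjoinRoot ψ
  set F := SuperellipticFunctionField k k p f
  set L' := SuperellipticFunctionField K' K' p (f.map (algebraMap k K'))
  set F' := AdjoinRoot (ψ.map (algebraMap k F))
  obtain ⟨i, hi, hiy⟩ := exists_ringHom_base (k := k) (p := p) (f := f) ψ
  have hi' : ∀ g : k[X], i (algebraMap k[X] F g) = algebraMap K'[X] L' (g.map (algebraMap k K')) := fun g =>
    RingHom.congr_fun hi g
  -- `i` on constants
  have hik : i.comp (algebraMap k F) = (algebraMap K' L').comp (algebraMap k K') := by
    ext c
    rw [RingHom.comp_apply, RingHom.comp_apply, IsScalarTower.algebraMap_apply k k[X] F, Polynomial.algebraMap_eq,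
      hi', Polynomial.map_C, IsScalarTower.algebraMap_apply K' K'[X] L', Polynomial.algebraMap_eq]
  -- the forward map `Θ₁ : F' → L'`
  set α' : L' := algebraMap K' L' (AdjoinRoot.root ψ) with hα'
  have hα : (ψ.map (algebraMap k F)).eval₂ i α' = 0 := by
    rw [eval₂_map, hik, hα', ← Polynomial.hom_eval₂, ← aeval_def, AdjoinRoot.aeval_eq, AdjoinRoot.mk_self, map_zero]
  set Θ₁ : F' →+* L' := AdjoinRoot.lift i α' hα with hΘ₁
  have hΘ₁of : ∀ z : F, Θ₁ (algebraMap F F' z) = i z := fun z => AdjoinRoot.lift_of hα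
  have hΘ₁root : Θ₁ (AdjoinRoot.root (ψ.map (algebraMap k F))) = α' := AdjoinRoot.lift_root hα
  have hΘ₁k : Θ₁.comp (algebraMap k F') = (algebraMap K' L').comp (algebraMap k K') := by
    ext c
    rw [RingHom.comp_apply, IsScalarTower.algebraMap_apply k F F', hΘ₁of, ← RingHom.comp_apply, hik]
  have hΘ₁K : ∀ c : K', Θ₁ (algebraMap K' F' c) = algebraMap K' L' c := by
    intro c
    induction c using AdjoinRoot.induction_on with
    | ih g =>
      rw [algebraMap_adjoinRoot_def, AdjoinRoot.lift_mk, Polynomial.hom_eval₂, hΘ₁k, hΘ₁root, hα',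
        ← Polynomial.hom_eval₂, ← aeval_def, AdjoinRoot.aeval_eq]
  set Θ : F' →ₐ[K'] L' := { Θ₁ with commutes' := hΘ₁K } with hΘ
  have hΘapply : ∀ z, Θ z = Θ₁ z := fun z => rfl
  -- the backward map `Θ₂ : L' → F'`
  set xF : F' := algebraMap F F' (genX k k p f) with hxF
  set yF : F' := algebraMap F F' (genY k k p f) with hyF
  have hxT : Transcendental K' xF := by
    have h1 : Transcendental k xF :=
      (transcendental_algebraMap_iff (algebraMap F F').injective).mpr (transcendental_genX k k p f)
    exact fun halg => h1 (halg.restrictScalars k)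
  set ι₂ : K'[X] →+* F' := (aeval xF : K'[X] →ₐ[K'] F').toRingHom with hι₂
  have hι₂inj : Function.Injective ι₂ := transcendental_iff_injective.mp hxT
  have hι₂apply : ∀ g : K'[X], ι₂ g = aeval xF g := fun g => rfl
  set j₀ : RatFunc K' →+* F' :=
    RatFunc.liftRingHom ι₂ (nonZeroDivisors_le_comap_nonZeroDivisors_of_injective ι₂ hι₂inj) with hj₀
  have hj₀ : ∀ g : K'[X], j₀ (algebraMap K'[X] (RatFunc K') g) = ι₂ g := fun g =>
    RatFunc.liftRingHom_algebraMap_polynomial ι₂ _ g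
  have hroot₂ : (superellipticPoly K' K' p (f.map (algebraMap k K'))).eval₂ j₀ yF = 0 := by
    rw [eval₂_superellipticPoly_ringHom, hj₀, hι₂apply, Polynomial.map_map, Algebra.algebraMap_self,
      RingHom.id_comp, Polynomial.aeval_map_algebraMap, hxF, Polynomial.aeval_algebraMap_apply, hyF,
      ← map_pow, genY_pow_eq_aeval, Algebra.algebraMap_self, Polynomial.map_id, sub_self]
  set Θ₂ : L' →+* F' := AdjoinRoot.lift j₀ yF hroot₂ with hΘ₂
  -- `Θ₁ ∘ Θ₂ = id`
  have hcomp : Θ₁.comp Θ₂ = RingHom.id L' := by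
    refine Ideal.Quotient.ringHom_ext (Polynomial.ringHom_ext' ?_ ?_)
    · -- on `RatFunc K'`
      have h0 : (Θ₁.comp Θ₂).comp (AdjoinRoot.of _) = AdjoinRoot.of (superellipticPoly K' K' p (f.map (algebraMap k K'))) := by
        refine IsLocalization.ringHom_ext (nonZeroDivisors K'[X]) (Polynomial.ringHom_ext' ?_ ?_)
        · refine RingHom.ext fun c => ?_
          simp only [RingHom.comp_apply]
          rw [AdjoinRoot.lift_of, hj₀, hι₂apply, aeval_C, hΘ₁K]
          rw [IsScalarTower.algebraMap_apply K' K'[X] L', IsScalarTower.algebraMap_apply K'[X] (RatFunc K') L',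
            Polynomial.algebraMap_apply]
          rfl
        · simp only [RingHom.comp_apply]
          rw [AdjoinRoot.lift_of, hj₀, hι₂apply, aeval_X, hxF, hΘ₁of, genX, hi', Polynomial.map_X,
            IsScalarTower.algebraMap_apply K'[X] (RatFunc K') L']
          rfl
      exact RingHom.ext fun r => RingHom.congr_fun h0 r
    · show (Θ₁.comp Θ₂) (AdjoinRoot.root _) = (RingHom.id L') (AdjoinRoot.root _)
      rw [RingHom.comp_apply, AdjoinRoot.lift_root, hyF, hΘ₁of, hiy, RingHom.id_apply]
      rfl
  have hsurj : Function.Surjective Θ := fun z => ⟨Θ₂ z, by rw [hΘapply, ← RingHom.comp_apply, hcomp, RingHom.id_apply]⟩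
  exact ⟨AlgEquiv.ofBijective Θ ⟨Θ₁.injective, hsurj⟩⟩

omit [Fact (Irreducible (superellipticPoly (AdjoinRoot ψ) (AdjoinRoot ψ) p (f.map (algebraMap k (AdjoinRoot ψ)))))] in
/-- **`N_1(F k_r / k_r) = N_r(F/k)` for `F = k(C_f)`** (Stichtenoth Lemma 5.1.9 (d) ⇒ eq. (5.40) at
`r = 1` upstairs): in the constant field extension `F' = F[X]/(ψ)`, `K' = k[X]/(ψ)`, `deg ψ = r`, the
`K'`-rational places are exactly the places above the places of `F` of degree dividing `r`, `d` of them
above a place of degree `d` — here obtained from the tree's double count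
(`mul_sum_natCard_fixed_eq_card_mul_pointCount`, whose index set of automorphisms fixing `K'` is `{1}`
since `F' = F(α)`) and `isRational_of_restrict_eq`. [cite: Stichtenoth2009, Lemma 5.1.9(d), eq. (5.40)] -/
theorem pointCount_one_model_eq [Fintype k] [IsIntegrallyClosedIn k (SuperellipticFunctionField k k p f)] :
    pointCount (AdjoinRoot ψ) (AdjoinRoot (ψ.map (algebraMap k (SuperellipticFunctionField k k p f)))) 1 =
      pointCount k (SuperellipticFunctionField k k p f) ψ.natDegree := by
  set K' := AdjoinRoot ψ
  set F := SuperellipticFunctionField k k p f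
  set F' := AdjoinRoot (ψ.map (algebraMap k F))
  haveI := isGalois_adjoinRoot_map (F := F) ψ
  have hr : 0 < ψ.natDegree := hψ.out.natDegree_pos
  have hK' : Nat.card K' = Nat.card k ^ ψ.natDegree := natCard_adjoinRoot ψ
  have hDC := PlaceOver.mul_sum_natCard_fixed_eq_card_mul_pointCount (k := k) (L := F) (Ω := F') (K' := K') hr hK'
    (fun P hP Q hQ => isRational_of_restrict_eq ψ P hP Q hQ)
  rw [natCard_algEquiv_adjoinRoot_map] at hDC
  -- the automorphisms of `F'/F` fixing `K'` pointwise: only the identity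
  have hpow : ∀ c : K', c ^ Nat.card k ^ ψ.natDegree = c := fun c => by
    letI : Fintype K' := Fintype.ofFinite K'
    rw [← hK', Nat.card_eq_fintype_card, FiniteField.pow_card]
  have hθ : ∀ θ : F' ≃ₐ[F] F', (∀ c : K', θ (algebraMap K' F' c) = algebraMap K' F' (c ^ Nat.card k ^ ψ.natDegree)) →
      θ = 1 := by
    intro θ hθc
    have hroot : (θ : F' →ₐ[F] F') (AdjoinRoot.root (ψ.map (algebraMap k F))) =
        (AlgHom.id F F') (AdjoinRoot.root (ψ.map (algebraMap k F))) := by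
      rw [AlgHom.id_apply, AlgEquiv.coe_toAlgHom, ← algebraMap_root ψ, hθc, hpow]
    have h := AdjoinRoot.algHom_ext hroot
    exact AlgEquiv.ext fun z => AlgHom.congr_fun h z
  have h1 : ∀ c : K', (1 : F' ≃ₐ[F] F') (algebraMap K' F' c) = algebraMap K' F' (c ^ Nat.card k ^ ψ.natDegree) :=
    fun c => by rw [hpow, AlgEquiv.one_apply]
  have huniv : (Finset.univ : Finset {θ : F' ≃ₐ[F] F' //
      ∀ c : K', θ (algebraMap K' F' c) = algebraMap K' F' (c ^ Nat.card k ^ ψ.natDegree)}) = {⟨1, h1⟩} :=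
    Finset.eq_singleton_iff_unique_mem.2 ⟨Finset.mem_univ _, fun θ _ => Subtype.ext (hθ θ.1 θ.2)⟩
  rw [huniv, Finset.sum_singleton] at hDC
  have hcomap : ∀ Q : PlaceOver K' F', Q.comapRingEquiv ((1 : F' ≃ₐ[F] F') : F' ≃+* F') = Q := fun Q => by
    ext x
    rw [PlaceOver.mem_comapRingEquiv_iff]
    rfl
  have hN : Nat.card {Q : PlaceOver K' F' // Q.IsRational ∧ Q.comapRingEquiv ((1 : F' ≃ₐ[F] F') : F' ≃+* F') = Q} =
      pointCount K' F' 1 := by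
    rw [pointCount_one]
    exact Nat.card_congr (Equiv.subtypeEquivRight fun Q => ⟨fun h => h.1, fun h => ⟨h, hcomap Q⟩⟩)
  have hDC' : ψ.natDegree * pointCount K' F' 1 = ψ.natDegree * pointCount k F ψ.natDegree := by
    rw [← hN]
    exact hDC
  exact Nat.eq_of_mul_eq_mul_left hr hDC'

/-- **`N_r(k(C_f)) = #{(a, b) ∈ 𝔽_{q^r}² : b^p = f(a)} + 1`**: the number of points of `C_f : y^p = f(x)`
over `𝔽_{q^r} = k[X]/(ψ)` (`deg ψ = r`), counted with the tree's `pointCount` (Stichtenoth (5.40):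
`N_r = ∑_{d ∣ r} d B_d`), is the naive affine count plus the point at infinity.
[cite: Stichtenoth2009, Lemma 5.1.9(d), eq. (5.40)] -/
theorem pointCount_natDegree_superelliptic [Fintype k] [Fact p.Prime] (hpk : (p : k) ≠ 0) (hsep : f.Separable)
    (hndvd : ¬ p ∣ f.natDegree) :
    pointCount k (SuperellipticFunctionField k k p f) ψ.natDegree =
      Nat.card {ab : AdjoinRoot ψ × AdjoinRoot ψ // ab.2 ^ p = (f.map (algebraMap k (AdjoinRoot ψ))).eval ab.1} + 1 := by
  letI : Fintype (AdjoinRoot ψ) := Fintype.ofFinite _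
  haveI : IsIntegrallyClosedIn k (SuperellipticFunctionField k k p f) :=
    isIntegrallyClosedIn_of_isRational (degree_inftyPlace hndvd)
  have hpk' : (p : AdjoinRoot ψ) ≠ 0 := by
    rw [Ne, ← map_natCast (algebraMap k (AdjoinRoot ψ)), map_eq_zero]
    exact hpk
  have hndvd' : ¬ p ∣ (f.map (algebraMap k (AdjoinRoot ψ))).natDegree := by rwa [natDegree_map]
  obtain ⟨e⟩ := nonempty_algEquiv_model (k := k) (p := p) (f := f) ψ
  rw [← pointCount_one_model_eq ψ, PlaceOver.pointCount_eq_of_algEquiv _ _ _ e 1,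
    pointCount_one_superelliptic hpk' hsep.map hndvd', Nat.card_eq_fintype_card]

end Model

/-! ### Counting `p`-th roots in a finite field -/

section EulerCount

variable {K : Type u} [Field K] [Fintype K] {p : ℕ} [hp : Fact p.Prime]

/-- **Euler's criterion for `p`-th powers in `𝔽_Q`, `p ∣ Q - 1`**: a nonzero `c` is a `p`-th power iff
`c^{(Q-1)/p} = 1` (the units are cyclic). [folklore] -/
theorem exists_pow_eq_iff_pow_card_sub_one_div (hpq : p ∣ Fintype.card K - 1) {c : K} (hc : c ≠ 0) :
    (∃ b : K, b ^ p = c) ↔ c ^ ((Fintype.card K - 1) / p) = 1 := by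
  obtain ⟨m, hm⟩ := hpq
  have hp0 : p ≠ 0 := hp.out.ne_zero
  have hdiv : (Fintype.card K - 1) / p = m := by rw [hm, Nat.mul_div_cancel_left _ hp.out.pos]
  rw [hdiv]
  constructor
  · rintro ⟨b, rfl⟩
    have hb : b ≠ 0 := fun h => hc (by rw [h, zero_pow hp0])
    rw [← pow_mul, ← hm, FiniteField.pow_card_sub_one_eq_one b hb]
  · intro h
    obtain ⟨g, hg⟩ := IsCyclic.exists_monoid_generator (α := Kˣ)
    obtain ⟨t, ht⟩ := hg (Units.mk0 c hc)
    have hord : orderOf g = Fintype.card K - 1 := by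
      rw [← Fintype.card_units, ← Nat.card_eq_fintype_card]
      exact orderOf_eq_card_of_forall_mem_powers hg
    have hgt : (g : K) ^ t = c := by
      have := congrArg (fun u : Kˣ => (u : K)) ht
      simpa using this
    have h1 : g ^ (t * m) = 1 := by
      ext
      rw [Units.val_pow_eq_pow_val, pow_mul, hgt, h, Units.val_one]
    have hdvd : Fintype.card K - 1 ∣ t * m := hord ▸ orderOf_dvd_of_pow_eq_one h1
    rw [hm] at hdvd
    have hm0 : m ≠ 0 := by
      rintro rfl
      rw [mul_zero] at hm
      have := Fintype.one_lt_card (α := K)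
      omega
    obtain ⟨s, rfl⟩ := Nat.dvd_of_mul_dvd_mul_right (Nat.pos_of_ne_zero hm0) hdvd
    exact ⟨(g : K) ^ s, by rw [← pow_mul, mul_comm, hgt]⟩

omit hp in
/-- **A primitive `p`-th root of unity in `𝔽_Q` for `p ∣ Q - 1`** (a suitable power of a generator of the
cyclic group of units). [folklore] -/
theorem exists_isPrimitiveRoot_of_dvd_card_sub_one (hpq : p ∣ Fintype.card K - 1) : ∃ ζ : K, IsPrimitiveRoot ζ p := by
  obtain ⟨g, hg⟩ := IsCyclic.exists_monoid_generator (α := Kˣ)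
  have hord : orderOf g = Fintype.card K - 1 := by
    rw [← Fintype.card_units, ← Nat.card_eq_fintype_card]
    exact orderOf_eq_card_of_forall_mem_powers hg
  obtain ⟨m, hm⟩ := hpq
  have hm0 : m ≠ 0 := by
    rintro rfl
    rw [mul_zero] at hm
    have := Fintype.one_lt_card (α := K)
    omega
  have hordm : orderOf (g ^ m) = p := by
    rw [orderOf_pow' g hm0, hord, hm, Nat.gcd_mul_left_left, Nat.mul_div_cancel _ (Nat.pos_of_ne_zero hm0)]
  have h1 : IsPrimitiveRoot (g ^ m) p := hordm ▸ IsPrimitiveRoot.orderOf (g ^ m)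
  exact ⟨((g ^ m : Kˣ) : K), IsPrimitiveRoot.coe_units_iff.2 h1⟩

/-- **The number of `p`-th roots of `c ≠ 0` in `𝔽_Q`, `p ∣ Q - 1`, is `p` or `0`** according as
`c^{(Q-1)/p} = 1` or not (there is a primitive `p`-th root of unity, so the `p`-th roots of a `p`-th power
are `p` in number, Mathlib `IsPrimitiveRoot.card_nthRoots`). [folklore] -/
theorem card_pow_eq_of_ne_zero (hpq : p ∣ Fintype.card K - 1) {c : K} (hc : c ≠ 0) :
    Fintype.card {b : K // b ^ p = c} = if c ^ ((Fintype.card K - 1) / p) = 1 then p else 0 := by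
  obtain ⟨ζ, hζ⟩ := exists_isPrimitiveRoot_of_dvd_card_sub_one (K := K) (p := p) hpq
  have hcard := hζ.card_nthRoots c
  have hnodup := IsPrimitiveRoot.nthRoots_nodup hζ hc
  rw [exists_pow_eq_iff_pow_card_sub_one_div (p := p) hpq hc] at hcard
  rw [← hcard, ← Multiset.toFinset_card_of_nodup hnodup, Fintype.card_subtype]
  congr 1
  ext b
  simp [mem_nthRoots hp.out.pos]

/-- **Points of `y^p = g(x)` over `𝔽_Q` by Euler's criterion**: `#{(a, b) : b^p = g(a)} = #{a : g(a) = 0} +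
p · #{a : g(a) ≠ 0, g(a)^{(Q-1)/p} = 1}` for `p ∣ Q - 1`. [folklore] -/
theorem card_affinePoints_eq_euler (hpq : p ∣ Fintype.card K - 1) (g : K[X]) :
    Fintype.card {ab : K × K // ab.2 ^ p = g.eval ab.1} =
      (Finset.univ.filter fun a : K => g.eval a = 0).card +
        p * (Finset.univ.filter fun a : K => g.eval a ≠ 0 ∧ g.eval a ^ ((Fintype.card K - 1) / p) = 1).card := by
  have e : {ab : K × K // ab.2 ^ p = g.eval ab.1} ≃ Σ a : K, {b : K // b ^ p = g.eval a} :=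
    { toFun := fun q => ⟨q.1.1, q.1.2, q.2⟩
      invFun := fun q => ⟨(q.1, q.2.1), q.2.2⟩
      left_inv := fun _ => rfl
      right_inv := fun _ => rfl }
  rw [Fintype.card_congr e, Fintype.card_sigma]
  have hfib : ∀ a : K, Fintype.card {b : K // b ^ p = g.eval a} =
      (if g.eval a = 0 then 1 else 0) + p * (if g.eval a ≠ 0 ∧ g.eval a ^ ((Fintype.card K - 1) / p) = 1 then 1 else 0) := by
    intro a
    by_cases ha : g.eval a = 0
    · rw [if_pos ha, if_neg (fun h => h.1 ha), mul_zero, add_zero, ha]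
      have : Unique {b : K // b ^ p = 0} :=
        { default := ⟨0, zero_pow hp.out.ne_zero⟩, uniq := fun b => Subtype.ext (pow_eq_zero_iff hp.out.ne_zero |>.1 b.2) }
      exact Fintype.card_unique
    · rw [if_neg ha, zero_add, card_pow_eq_of_ne_zero hpq ha]
      by_cases hc : g.eval a ^ ((Fintype.card K - 1) / p) = 1
      · rw [if_pos hc, if_pos ⟨ha, hc⟩, mul_one]
      · rw [if_neg hc, if_neg (fun h => hc h.2), mul_zero]
  simp only [hfib, Finset.sum_add_distrib, ← Finset.mul_sum, Finset.sum_boole, Nat.cast_id]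

end EulerCount

end SuperellipticFunctionField


/-! ### `y³ = f(x)` has positive genus over every constant field `L ∋ ζ₃`, `char L ≠ 3` (`ℒ(∞_C) = L`) -/

namespace SuperellipticFunctionField

section GenusPos

variable {K : Type u} [Field K] {L : Type v} [Field L] [Algebra K L] {p : ℕ} [hp : Fact p.Prime] {f : K[X]}
variable [Fact (Irreducible (superellipticPoly K L p f))]

/-- **Rational functions of `x` with poles only at `∞_C` are polynomials of controlled degree**: if
`w ∈ L(x)` satisfies `w ∈ ℒ(m ∞_C)` inside `L(C_f)` (`p ∤ deg f`), then `w = g(x)` with `g ∈ L[X]` and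
`p · deg g ≤ m` (a finite pole of `w` would give a pole of `w` at a place of `L(C_f)` above it, and
`v_{∞_C}(g) = -p deg g`). [cite: Stichtenoth2009, Prop. 3.1.4 and Prop. 1.2.1] -/
theorem exists_polynomial_of_algebraMap_mem_riemannRochSpace (hndvd : ¬ p ∣ f.natDegree) {w : RatFunc L} (m : ℕ)
    (hw : algebraMap (RatFunc L) (SuperellipticFunctionField K L p f) w ∈
      riemannRochSpace ((m : ℤ) • Finsupp.single (inftyPlace K L p f) 1)) :
    ∃ g : L[X], algebraMap L[X] (RatFunc L) g = w ∧ (p : ℤ) * g.natDegree ≤ m := by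
  rcases eq_or_ne w 0 with rfl | hw0
  · exact ⟨0, by simp, by simp⟩
  set z := algebraMap (RatFunc L) (SuperellipticFunctionField K L p f) w with hz
  have hz0 : z ≠ 0 := (_root_.map_ne_zero _).2 hw0
  have hnonneg := (mem_riemannRochSpace_iff_nonneg _ hz0).1 hw
  -- no finite poles: `w ∈ L[x]`
  have hint : ∀ q : HeightOneSpectrum L[X], q.valuation (RatFunc L) w ≤ 1 := by
    intro q
    obtain ⟨Q, hQ⟩ := PlaceOver.exists_restrict_eq' (K := L) (F := RatFunc L) (F' := SuperellipticFunctionField K L p f)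
      (PlaceOver.ofPrime L (RatFunc L) q)
    have hQinf : Q ≠ inftyPlace K L p f := by
      intro h
      have h1 := congrArg (PlaceOver.restrict (K := L) (F := RatFunc L)) h
      rw [hQ, restrict_inftyPlace] at h1
      exact ofPrime_ne_ratFuncInftyPlace q h1
    have h0 := hnonneg Q
    rw [Finsupp.coe_zero, Pi.zero_apply, Finsupp.add_apply, principalDivisor_apply_of_ne_zero hz0, Finsupp.smul_apply,
      Finsupp.single_eq_of_ne hQinf, smul_zero, add_zero, hz, ord_algebraMap_ratFunc, hQ] at h0
    have h1 : 0 ≤ (PlaceOver.ofPrime L (RatFunc L) q).ord w := by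
      have he := one_le_ramificationIdx (K := K) (L := L) (p := p) (f := f) Q
      by_contra hneg
      push Not at hneg
      have : ramificationIdx K L p f Q * (PlaceOver.ofPrime L (RatFunc L) q).ord w < 0 :=
        mul_neg_of_pos_of_neg (by omega) hneg
      omega
    exact ((PlaceOver.ofPrime L (RatFunc L) q).mem_toValuationSubring_iff_ord_nonneg hw0).2 h1
  obtain ⟨g, hg⟩ := HeightOneSpectrum.mem_integers_of_valuation_le_one (RatFunc L) w hint
  refine ⟨g, hg, ?_⟩
  have hg0 : g ≠ 0 := by rintro rfl; exact hw0 (by rw [← hg, map_zero])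
  -- the pole order at `∞_C`
  have h0 := hnonneg (inftyPlace K L p f)
  rw [Finsupp.coe_zero, Pi.zero_apply, Finsupp.add_apply, principalDivisor_apply_of_ne_zero hz0, Finsupp.smul_apply,
    Finsupp.single_eq_same, hz, ord_algebraMap_ratFunc, restrict_inftyPlace, ramificationIdx_inftyPlace hndvd, ← hg,
    ord_ratFuncInftyPlace_algebraMap L hg0] at h0
  simp only [smul_eq_mul, mul_one] at h0
  linarith

/-- **No nonzero monomial `r(x) y^j`, `0 < j < p`, has its only pole at `∞_C` of order `≤ 1`** when `f`
is separable of degree `≥ 2` (`p ∤ deg f`): `(r y^j)^p = r^p f^j` would be a polynomial of degree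
`≤ 1`, but `r = u/v` in lowest terms forces `v^p ∣ f^j`, `v = 1` (`f` squarefree, `j < p`), and then
`deg (u^p f^j) ≥ deg f ≥ 2`. [folklore] -/
theorem smul_genY_pow_notMem_riemannRochSpace (hsep : f.Separable) (hndvd : ¬ p ∣ f.natDegree) (h2 : 2 ≤ f.natDegree)
    {r : RatFunc L} (hr : r ≠ 0) {j : ℕ} (hj0 : 0 < j) (hjp : j < p) :
    r • genY K L p f ^ j ∉ riemannRochSpace (Finsupp.single (inftyPlace K L p f) 1) := by
  intro hmem
  set fL := f.map (algebraMap K L) with hfL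
  have hfL0 : fL ≠ 0 := Polynomial.map_ne_zero hsep.ne_zero
  have hsq : Squarefree fL := hsep.map.squarefree
  -- `(r y^j)^p = r^p f^j`
  have hpow : (r • genY K L p f ^ j) ^ p = algebraMap (RatFunc L) (SuperellipticFunctionField K L p f)
      (r ^ p * algebraMap L[X] (RatFunc L) fL ^ j) := by
    rw [Algebra.smul_def, mul_pow, ← pow_mul, mul_comm j p, pow_mul, genY_pow, map_mul, map_pow, map_pow,
      ← IsScalarTower.algebraMap_apply]
  have hmem' := pow_mem_riemannRochSpace_nsmul hmem p
  rw [hpow, ← natCast_zsmul] at hmem'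
  obtain ⟨g, hg, hdeg⟩ := exists_polynomial_of_algebraMap_mem_riemannRochSpace (K := K) hndvd p hmem'
  have hdeg1 : g.natDegree ≤ 1 := by
    have hp1 : (1 : ℤ) ≤ p := by exact_mod_cast hp.out.one_lt.le
    nlinarith
  -- clear denominators: `num^p f^j = g denom^p`
  have hnum : r.num ≠ 0 := RatFunc.num_ne_zero hr
  have hden : r.denom ≠ 0 := RatFunc.denom_ne_zero r
  have hcop : IsCoprime r.num r.denom := RatFunc.isCoprime_num_denom r
  have heq : r.num ^ p * fL ^ j = g * r.denom ^ p := by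
    have hd' : algebraMap L[X] (RatFunc L) r.denom ≠ 0 := (map_ne_zero_iff _ (IsFractionRing.injective L[X] (RatFunc L))).2 hden
    have hnum' : algebraMap L[X] (RatFunc L) r.num = r * algebraMap L[X] (RatFunc L) r.denom := by
      rw [← div_eq_iff hd', RatFunc.num_div_denom]
    apply IsFractionRing.injective L[X] (RatFunc L)
    rw [map_mul, map_pow, hnum', map_mul, hg, map_pow, map_pow, mul_pow]
    ring
  -- `denom^p ∣ f^j`, hence `denom` is a unit
  have hdvd : r.denom ^ p ∣ fL ^ j := by
    have h1 : r.denom ^ p ∣ r.num ^ p * fL ^ j := ⟨g, by rw [heq, mul_comm]⟩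
    exact (hcop.pow (m := p) (n := p)).symm.dvd_of_dvd_mul_left h1
  have hunit : IsUnit r.denom := by
    by_contra hnu
    obtain ⟨π, hπ, hπd⟩ := WfDvdMonoid.exists_irreducible_factor hnu hden
    have hπp : Prime π := hπ.prime
    have h1 : π ^ p ∣ fL ^ j := (pow_dvd_pow_of_dvd hπd p).trans hdvd
    have h2 : π ∣ fL := hπp.dvd_of_dvd_pow ((dvd_pow_self π hp.out.ne_zero).trans h1)
    obtain ⟨f₁, hf₁⟩ := h2
    have h3 : ¬ π ∣ f₁ := by
      rintro ⟨f₂, rfl⟩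
      exact hπ.not_isUnit (hsq π ⟨f₂, by rw [hf₁, mul_assoc]⟩)
    rw [hf₁, mul_pow] at h1
    have h4 : π ^ (p - j) ∣ f₁ ^ j := by
      have h5 : π ^ p = π ^ j * π ^ (p - j) := by rw [← pow_add, Nat.add_sub_cancel' hjp.le]
      rw [h5] at h1
      exact (mul_dvd_mul_iff_left (pow_ne_zero j hπp.ne_zero)).1 h1
    have h6 : π ∣ f₁ ^ j := (dvd_pow_self π (by omega)).trans h4
    exact h3 (hπp.dvd_of_dvd_pow h6)
  have hden1 : r.denom = 1 := (Polynomial.Monic.isUnit_iff (RatFunc.monic_denom r)).1 hunit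
  rw [hden1, one_pow, mul_one] at heq
  -- degrees
  have hdegL : (r.num ^ p * fL ^ j).natDegree = p * r.num.natDegree + j * fL.natDegree := by
    rw [natDegree_mul (pow_ne_zero _ hnum) (pow_ne_zero _ hfL0), natDegree_pow, natDegree_pow]
  rw [heq] at hdegL
  have hn : fL.natDegree = f.natDegree := natDegree_map _
  have h3 : 1 * 2 ≤ j * fL.natDegree := Nat.mul_le_mul hj0 (hn ▸ h2)
  have h4 : j * fL.natDegree ≤ g.natDegree := by rw [hdegL]; exact Nat.le_add_left _ _
  have h5 := le_trans h3 (le_trans h4 hdeg1)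
  norm_num at h5

/-- **A deck eigenvector with at most a simple pole at `∞_C` is constant** (`f` separable of degree
`≥ 2`, `p ∤ deg f`): an eigenvector of `y ↦ ζ₀ y` is a monomial `r(x) y^j`
(`exists_eq_smul_genY_pow`); `j ≥ 1` is excluded by `smul_genY_pow_notMem_riemannRochSpace`, and for
`j = 0`, `r ∈ L(x) ∩ ℒ(∞_C)` is a polynomial of degree `≤ 1/p`, a constant. [folklore] -/
theorem exists_eq_algebraMap_of_deck_smul_eq {ζ₀ : L} (hζ₀ : IsPrimitiveRoot ζ₀ p) (hsep : f.Separable)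
    (hndvd : ¬ p ∣ f.natDegree) (h2 : 2 ≤ f.natDegree) {h : SuperellipticFunctionField K L p f}
    (hmem : h ∈ riemannRochSpace (Finsupp.single (inftyPlace K L p f) 1)) {c : L}
    (hc : CyclicCoverDeck.ofRoot hζ₀.pow_eq_one • h = algebraMap L _ c * h) :
    ∃ a : L, h = algebraMap L _ a := by
  rcases eq_or_ne h 0 with rfl | hh0
  · exact ⟨0, by simp⟩
  obtain ⟨j, r, hjp, hhr⟩ := exists_eq_smul_genY_pow hζ₀ hh0 hc
  have hr0 : r ≠ 0 := by rintro rfl; rw [zero_smul] at hhr; exact hh0 hhr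
  rcases Nat.eq_zero_or_pos j with rfl | hj0
  · rw [pow_zero, Algebra.smul_def, mul_one] at hhr
    rw [hhr] at hmem
    have hmem' : algebraMap (RatFunc L) (SuperellipticFunctionField K L p f) r ∈
        riemannRochSpace (((1 : ℕ) : ℤ) • Finsupp.single (inftyPlace K L p f) 1) := by simpa using hmem
    obtain ⟨g, hg, hdeg⟩ := exists_polynomial_of_algebraMap_mem_riemannRochSpace (K := K) hndvd 1 hmem'
    have hg0 : g.natDegree = 0 := by
      have hdeg' : p * g.natDegree ≤ 1 := by exact_mod_cast hdeg
      rcases Nat.eq_zero_or_pos g.natDegree with h0 | hpos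
      · exact h0
      · exact absurd (le_trans (Nat.mul_le_mul hp.out.two_le hpos) hdeg') (by norm_num)
    obtain ⟨a, rfl⟩ := Polynomial.natDegree_eq_zero.1 hg0
    refine ⟨a, ?_⟩
    rw [hhr, ← hg, RatFunc.algebraMap_C, IsScalarTower.algebraMap_apply L (RatFunc L) (SuperellipticFunctionField K L p f),
      RatFunc.algebraMap_eq_C]
  · exact absurd (hhr ▸ hmem) (smul_genY_pow_notMem_riemannRochSpace hsep hndvd h2 hr0 hj0 hjp)

end GenusPos

section GenusPosThree

variable {K : Type u} [Field K] {L : Type v} [Field L] [Algebra K L] {f : K[X]}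
variable [Fact (Irreducible (superellipticPoly K L 3 f))]

/-- **`ℒ(∞_C) = L` for `C_f : y³ = f(x)`** over a field `L ∋ ζ₃` of characteristic `≠ 3`, `f` separable
of degree `≥ 2` prime to `3`: decompose `z ∈ ℒ(∞_C)` into the three eigencomponents of the deck
transformation `y ↦ ζ₃ y` (which fixes `∞_C`, so preserves `ℒ(∞_C)`); each is constant
(`exists_eq_algebraMap_of_deck_smul_eq`). [folklore] -/
theorem exists_eq_algebraMap_of_mem_riemannRochSpace_inftyPlace {ζ₀ : L} (hζ₀ : IsPrimitiveRoot ζ₀ 3) (h3 : (3 : L) ≠ 0)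
    (hsep : f.Separable) (hndvd : ¬ 3 ∣ f.natDegree) (h2 : 2 ≤ f.natDegree) {z : SuperellipticFunctionField K L 3 f}
    (hz : z ∈ riemannRochSpace (Finsupp.single (inftyPlace K L 3 f) 1)) :
    ∃ a : L, z = algebraMap L _ a := by
  haveI : Fact (Nat.Prime 3) := ⟨Nat.prime_three⟩
  set δ : CyclicCoverDeck L 3 := CyclicCoverDeck.ofRoot hζ₀.pow_eq_one with hδ
  have hcdef : ∀ a : L, ∀ w : SuperellipticFunctionField K L 3 f,
      δ • (algebraMap L _ a * w) = algebraMap L _ a * (δ • w) := fun a w => by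
    rw [smul_mul', deck_smul_algebraMap]
  set c : SuperellipticFunctionField K L 3 f := algebraMap L _ ζ₀ with hc
  set V := riemannRochSpace (K := L) (F := SuperellipticFunctionField K L 3 f) (Finsupp.single (inftyPlace K L 3 f) 1) with hV
  -- `V` is stable under `δ` (`δ ∞_C = ∞_C`)
  have hD : δ • (Finsupp.single (inftyPlace K L 3 f) (1 : ℤ) : Divisor L (SuperellipticFunctionField K L 3 f)) =
      Finsupp.single (inftyPlace K L 3 f) 1 := by
    ext Q
    rw [smul_divisor_apply, Finsupp.single_apply, Finsupp.single_apply, eq_inv_smul_iff, deck_smul_inftyPlace hndvd]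
  have hstab : ∀ w ∈ V, δ • w ∈ V := by
    intro w hw
    rcases eq_or_ne w 0 with rfl | hw0
    · rw [smul_zero]; exact V.zero_mem
    have hδw0 : δ • w ≠ 0 := (smul_ne_zero_iff_ne δ).2 hw0
    have h0 := (mem_riemannRochSpace_iff_nonneg _ hw0).1 hw
    rw [hV, mem_riemannRochSpace_iff_nonneg _ hδw0, ← smul_principalDivisor, ← hD, ← smul_add]
    intro Q
    rw [Finsupp.coe_zero, Pi.zero_apply, smul_divisor_apply]
    exact h0 _
  have hc3 : c ^ 3 = 1 := by rw [hc, ← map_pow, hζ₀.pow_eq_one, map_one]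
  have hc2 : 1 + c + c ^ 2 = 0 := by
    have h := hζ₀.geom_sum_eq_zero (by norm_num : 1 < 3)
    rw [Finset.sum_range_succ, Finset.sum_range_succ, Finset.sum_range_succ, Finset.sum_range_zero] at h
    simp only [pow_zero, pow_one, zero_add] at h
    have h' := congrArg (algebraMap L (SuperellipticFunctionField K L 3 f)) h
    rw [map_add, map_add, map_pow, map_one, map_zero] at h'
    rw [hc]
    linear_combination h'
  have hδpow : δ ^ 3 = 1 := CyclicCoverDeck.ofRoot_pow_eq_one _
  have hδ3 : ∀ w : SuperellipticFunctionField K L 3 f, δ • (δ • (δ • w)) = w := fun w => by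
    rw [← mul_smul, ← mul_smul, ← pow_three', hδpow, one_smul]
  have hδc : ∀ w : SuperellipticFunctionField K L 3 f, δ • (c * w) = c * (δ • w) := fun w => hcdef ζ₀ w
  have hδc2 : ∀ w : SuperellipticFunctionField K L 3 f, δ • (c ^ 2 * w) = c ^ 2 * (δ • w) := fun w => by
    rw [hc, ← map_pow]; exact hcdef _ w
  -- the three eigencomponents
  set z₀ := z + δ • z + δ • (δ • z) with hz₀
  set z₁ := z + c ^ 2 * (δ • z) + c * (δ • (δ • z)) with hz₁
  set z₂ := z + c * (δ • z) + c ^ 2 * (δ • (δ • z)) with hz₂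
  have hsum : z₀ + z₁ + z₂ = 3 * z := by
    rw [hz₀, hz₁, hz₂]; linear_combination (δ • z + δ • (δ • z)) * hc2
  have hz1 : δ • z ∈ V := hstab z hz
  have hz2 : δ • (δ • z) ∈ V := hstab _ hz1
  have hcV : ∀ (a : L) (w : SuperellipticFunctionField K L 3 f), w ∈ V → algebraMap L _ a * w ∈ V := fun a w hw => by
    rw [← Algebra.smul_def]; exact V.smul_mem a hw
  have hz₀V : z₀ ∈ V := V.add_mem (V.add_mem hz hz1) hz2
  have hz₁V : z₁ ∈ V := by
    have e1 : c ^ 2 * (δ • z) = algebraMap L _ (ζ₀ ^ 2) * (δ • z) := by rw [map_pow]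
    rw [hz₁, e1]
    exact V.add_mem (V.add_mem hz (hcV _ _ hz1)) (hcV _ _ hz2)
  have hz₂V : z₂ ∈ V := by
    have e2 : c ^ 2 * (δ • (δ • z)) = algebraMap L _ (ζ₀ ^ 2) * (δ • (δ • z)) := by rw [map_pow]
    rw [hz₂, e2]
    exact V.add_mem (V.add_mem hz (hcV _ _ hz1)) (hcV _ _ hz2)
  have heig₀ : δ • z₀ = algebraMap L _ 1 * z₀ := by
    rw [map_one, one_mul, hz₀, smul_add, smul_add, hδ3]; abel
  have heig₁ : δ • z₁ = algebraMap L _ ζ₀ * z₁ := by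
    rw [← hc, hz₁, smul_add, smul_add, hδc2, hδc, hδ3]
    linear_combination (-(δ • z)) * hc3
  have heig₂ : δ • z₂ = algebraMap L _ (ζ₀ ^ 2) * z₂ := by
    rw [map_pow, ← hc, hz₂, smul_add, smul_add, hδc, hδc2, hδ3]
    linear_combination (-(δ • z + c * (δ • (δ • z)))) * hc3
  obtain ⟨a₀, ha₀⟩ := exists_eq_algebraMap_of_deck_smul_eq hζ₀ hsep hndvd h2 hz₀V heig₀
  obtain ⟨a₁, ha₁⟩ := exists_eq_algebraMap_of_deck_smul_eq hζ₀ hsep hndvd h2 hz₁V heig₁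
  obtain ⟨a₂, ha₂⟩ := exists_eq_algebraMap_of_deck_smul_eq hζ₀ hsep hndvd h2 hz₂V heig₂
  refine ⟨3⁻¹ * (a₀ + a₁ + a₂), ?_⟩
  have h3F : (3 : SuperellipticFunctionField K L 3 f) ≠ 0 := by
    rw [Ne, ← map_ofNat (algebraMap L (SuperellipticFunctionField K L 3 f)) 3, map_eq_zero]
    exact h3
  apply mul_left_cancel₀ h3F
  rw [← hsum, ha₀, ha₁, ha₂, ← map_add, ← map_add, map_mul, map_inv₀, map_ofNat, ← mul_assoc, mul_inv_cancel₀ h3F,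
    one_mul]

/-- **`ℓ(∞_C) = 1`** for `C_f : y³ = f(x)` as above. [folklore] -/
theorem ell_single_inftyPlace_eq_one {ζ₀ : L} (hζ₀ : IsPrimitiveRoot ζ₀ 3) (h3 : (3 : L) ≠ 0)
    (hsep : f.Separable) (hndvd : ¬ 3 ∣ f.natDegree) (h2 : 2 ≤ f.natDegree) :
    ell (Finsupp.single (inftyPlace K L 3 f) 1 : Divisor L (SuperellipticFunctionField K L 3 f)) = 1 := by
  have hle : riemannRochSpace (K := L) (F := SuperellipticFunctionField K L 3 f) (Finsupp.single (inftyPlace K L 3 f) 1) =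
      LinearMap.range (Algebra.linearMap L (SuperellipticFunctionField K L 3 f)) := by
    apply le_antisymm
    · intro z hz
      obtain ⟨a, rfl⟩ := exists_eq_algebraMap_of_mem_riemannRochSpace_inftyPlace hζ₀ h3 hsep hndvd h2 hz
      exact ⟨a, rfl⟩
    · rintro _ ⟨a, rfl⟩
      exact riemannRochSpace_mono (Finsupp.single_nonneg.2 zero_le_one) (algebraMap_mem_riemannRochSpace_zero a)
  rw [ell, hle, LinearMap.finrank_range_of_inj (algebraMap L (SuperellipticFunctionField K L 3 f)).injective,
    Module.finrank_self]

/-- **The curves `y³ = f(x)` have positive genus** (`f` separable of degree `≥ 2` prime to `3`, over a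
constant field `L ∋ ζ₃` of characteristic `≠ 3`): Riemann's inequality at the rational place `∞_C`
gives `deg ∞_C + 1 - g ≤ ℓ(∞_C) = 1`. (For `L` algebraically closed and `deg f = 4` the genus is `3`,
`genus_superelliptic_three_four`.) [cite: Stichtenoth2009, Thm. 1.4.17(a)] -/
theorem one_le_genus_superelliptic_three {ζ₀ : L} (hζ₀ : IsPrimitiveRoot ζ₀ 3) (h3 : (3 : L) ≠ 0)
    (hsep : f.Separable) (hndvd : ¬ 3 ∣ f.natDegree) (h2 : 2 ≤ f.natDegree) :
    1 ≤ genus L (SuperellipticFunctionField K L 3 f) := by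
  haveI : Fact (Nat.Prime 3) := ⟨Nat.prime_three⟩
  have hR := degree_add_one_sub_genus_le_ell (K := L) (F := SuperellipticFunctionField K L 3 f)
    (Finsupp.single (inftyPlace K L 3 f) 1)
  rw [ell_single_inftyPlace_eq_one hζ₀ h3 hsep hndvd h2, Divisor.degree_single, degree_inftyPlace hndvd] at hR
  push_cast at hR
  omega

end GenusPosThree

/-! ### The special fibre: `T₃ Pic(C_{f,Ω}) ≠ 0` from the twisted Lefschetz formula and Hasse–Weil -/

section Weil

/-- **If `T₃ Pic(C_{f,Ω}) = 0` then `N_r(k(C_f)) = q^r + 1` for every `r ≥ 1`** (`k = 𝔽_q ∋ ζ₃`, `Ω ⊇ k`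
algebraically closed and algebraic, `f ∈ k[X]` a separable quartic), GIVEN the twisted Lefschetz trace
formula `hX3`: at the level `K' = 𝔽_{q^r} = k[X]/(ψ) ⊂ Ω` the Tate module still vanishes
(`subsingleton_tateModule_superellipticPic_iff`), so `hX3` for the `q^r`-Frobenius (trivial twist) gives
`#Fix(Frob_{q^r}) = q^r + 1`, and this count is `1 + #{(a, b) ∈ 𝔽_{q^r}² : b³ = f(a)} = N_r(k(C_f))`
(`card_fixedPlaces_frobenius_deck`, `card_affinePoints_eq_euler`, `pointCount_natDegree_superelliptic`).
[cite: Milne1986JacobianVarieties, §11 Prop. 11.2] [cite: Stichtenoth2009, Lemma 5.1.9(d), eq. (5.40)] -/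
theorem pointCount_eq_pow_add_one_of_subsingleton
    (hX3 : ∀ (k : Type) [Field k] [Fintype k] (Ω : Type) [Field Ω] [Algebra k Ω] [IsAlgClosed Ω]
      [Algebra.IsAlgebraic k Ω] (p : ℕ) [Fact p.Prime] (ℓ : ℕ) [Fact ℓ.Prime] (f : k[X]),
      (p : k) ≠ 0 → (ℓ : k) ≠ 0 → f.Separable → ¬ p ∣ f.natDegree →
      ∀ [Fact (Irreducible (superellipticPoly k Ω p f))] (φ : Ω ≃ₐ[k] Ω), (∀ x : Ω, φ x = x ^ Fintype.card k) →
      ∀ (ξ : CyclicCoverDeck Ω p),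
        LinearMap.trace ℚ_[ℓ] (RationalTateModule (SuperellipticPic k Ω p f) ℓ)
          (rationalTateRepresentation (Ω ≃ₐ[k] Ω) (SuperellipticPic k Ω p f) ℓ φ ∘ₗ
            rationalTateRepresentation (CyclicCoverDeck Ω p) (SuperellipticPic k Ω p f) ℓ ξ) =
          (Fintype.card k : ℚ_[ℓ]) + 1 -
            Nat.card {P : PlaceOver Ω (SuperellipticFunctionField k Ω p f) // φ • (ξ • P) = P})
    {k : Type} [Field k] [Fintype k] {Ω : Type} [Field Ω] [Algebra k Ω] [IsAlgClosed Ω] [Algebra.IsAlgebraic k Ω]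
    {f : k[X]} (h3 : (3 : k) ≠ 0) (hsep : f.Separable) (hdeg : f.natDegree = 4) (hq : 3 ∣ Fintype.card k - 1)
    [Fact (Irreducible (superellipticPoly k Ω 3 f))] [Fact (Irreducible (superellipticPoly k k 3 f))]
    (φ : Ω ≃ₐ[k] Ω) (hφ : ∀ x : Ω, φ x = x ^ Fintype.card k)
    [Subsingleton (TateModule (SuperellipticPic k Ω 3 f) 3)] {r : ℕ} (hr : 0 < r) :
    pointCount k (SuperellipticFunctionField k k 3 f) r = Fintype.card k ^ r + 1 := by
  haveI : Fact (Nat.Prime 3) := ⟨Nat.prime_three⟩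
  have hndvd : ¬ 3 ∣ f.natDegree := by rw [hdeg]; decide
  obtain ⟨ψ, -, hirr, -, hψdeg⟩ := exists_irreducible_natDegree_eq k hr
  haveI : Fact (Irreducible ψ) := ⟨hirr⟩
  letI : Fintype (AdjoinRoot ψ) := Fintype.ofFinite _
  -- the level field `K' = k[X]/(ψ) = 𝔽_{q^r}` inside `Ω`
  letI : Algebra (AdjoinRoot ψ) Ω := (IsAlgClosed.lift : AdjoinRoot ψ →ₐ[k] Ω).toRingHom.toAlgebra
  haveI : IsScalarTower k (AdjoinRoot ψ) Ω :=
    IsScalarTower.of_algebraMap_eq fun x => ((IsAlgClosed.lift : AdjoinRoot ψ →ₐ[k] Ω).commutes x).symm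
  haveI : Algebra.IsAlgebraic (AdjoinRoot ψ) Ω := Algebra.IsAlgebraic.tower_top (K := k) (AdjoinRoot ψ)
  set f' := f.map (algebraMap k (AdjoinRoot ψ)) with hf'
  have hsep' : f'.Separable := hsep.map
  have hdeg' : f'.natDegree = 4 := by rw [hf', natDegree_map, hdeg]
  have hndvd' : ¬ 3 ∣ f'.natDegree := by rw [hdeg']; decide
  haveI : Fact (Irreducible (superellipticPoly (AdjoinRoot ψ) (AdjoinRoot ψ) 3 f')) :=
    fact_irreducible_superellipticPoly _ _ f' hsep' (by rw [hdeg']; norm_num)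
  haveI : Fact (Irreducible (superellipticPoly (AdjoinRoot ψ) Ω 3 f')) :=
    fact_irreducible_superellipticPoly _ _ f' hsep' (by rw [hdeg']; norm_num)
  have h3' : (3 : AdjoinRoot ψ) ≠ 0 := by
    rw [Ne, ← map_ofNat (algebraMap k (AdjoinRoot ψ)) 3, map_eq_zero]
    exact h3
  have hcardK' : Fintype.card (AdjoinRoot ψ) = Fintype.card k ^ r := by
    rw [← Nat.card_eq_fintype_card, natCard_adjoinRoot, Nat.card_eq_fintype_card, hψdeg]
  have hq' : 3 ∣ Fintype.card (AdjoinRoot ψ) - 1 := by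
    rw [hcardK']
    exact hq.trans (by simpa using Nat.sub_dvd_pow_sub_pow (Fintype.card k) 1 r)
  obtain ⟨φ', hφ'⟩ := exists_algEquiv_apply_eq_pow_card (K' := AdjoinRoot ψ) φ hφ r hcardK'
  -- the Tate module vanishes at level `K'` too, hence so does every trace on `V₃`
  have hpoly : superellipticPoly (AdjoinRoot ψ) Ω 3 f' = superellipticPoly k Ω 3 f := superellipticPoly_map_eq 3 f
  haveI : Subsingleton (TateModule (SuperellipticPic (AdjoinRoot ψ) Ω 3 f') 3) :=
    (subsingleton_tateModule_superellipticPic_iff hpoly 3).2 inferInstance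
  haveI := subsingleton_rationalTateModule (A := SuperellipticPic (AdjoinRoot ψ) Ω 3 f') (ℓ := 3)
  have hlef := hX3 (AdjoinRoot ψ) Ω 3 3 f' h3' h3' hsep' hndvd' φ' hφ' 1
  rw [trace_eq_zero_of_subsingleton] at hlef
  -- the fixed places of `Frob_{q^r}` and the naive count over `𝔽_{q^r}`
  have hfix := card_fixedPlaces_frobenius_deck (k := AdjoinRoot ψ) (Ω := Ω) (p := 3) (f := f') φ' hφ' h3' hsep' hndvd' hq' 1
  have hfilter : (Finset.univ.filter fun a : AdjoinRoot ψ => f'.eval a ≠ 0 ∧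
      algebraMap (AdjoinRoot ψ) Ω (f'.eval a) ^ ((Fintype.card (AdjoinRoot ψ) - 1) / 3) = (1 : CyclicCoverDeck Ω 3).val) =
      (Finset.univ.filter fun a : AdjoinRoot ψ => f'.eval a ≠ 0 ∧ f'.eval a ^ ((Fintype.card (AdjoinRoot ψ) - 1) / 3) = 1) := by
    refine Finset.filter_congr fun a _ => and_congr_right fun _ => ?_
    rw [CyclicCoverDeck.val_one, ← map_pow, map_eq_one_iff _ (algebraMap (AdjoinRoot ψ) Ω).injective]
  have heuler := card_affinePoints_eq_euler (K := AdjoinRoot ψ) (p := 3) hq' f'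
  have hNr := pointCount_natDegree_superelliptic (k := k) (p := 3) (f := f) ψ h3 hsep hndvd
  rw [hψdeg] at hNr
  have hcast : (Nat.card {P : PlaceOver Ω (SuperellipticFunctionField (AdjoinRoot ψ) Ω 3 f') //
      φ' • ((1 : CyclicCoverDeck Ω 3) • P) = P} : ℚ_[3]) = (Fintype.card (AdjoinRoot ψ) : ℚ_[3]) + 1 := by
    linear_combination hlef
  have hNnat : Nat.card {P : PlaceOver Ω (SuperellipticFunctionField (AdjoinRoot ψ) Ω 3 f') //
      φ' • ((1 : CyclicCoverDeck Ω 3) • P) = P} = Fintype.card (AdjoinRoot ψ) + 1 := by exact_mod_cast hcast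
  rw [hfix, hfilter] at hNnat
  rw [hNr, Nat.card_eq_fintype_card, heuler, ← hcardK']
  linarith

/-- **`T₃ Pic(C_{f,Ω}) ≠ 0` for the curves `y³ = f₄(x)` over `Ω = 𝔽̄_q`, from the twisted Lefschetz trace
formula and the Hasse–Weil theorem** (`k = 𝔽_q ∋ ζ₃`, `3 ∤ q`, `f ∈ k[X]` a separable quartic, `φ` the
`q`-Frobenius of `Ω/k`).  If the Tate module vanished, `N_r(k(C_f)) = q^r + 1` for all `r ≥ 1`
(`pointCount_eq_pow_add_one_of_subsingleton`), i.e. `∑ᵢ αᵢ^r = 0` for the `2g` reciprocal roots of the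
`L`-polynomial, all of absolute value `√q` (Hasse–Weil, PROVED in the tree: `hasseWeil_holds`,
`lSeries_eq_polynomial_holds`, `exists_pointCount_eq_of_facts`); Artin's independence of characters then forces
`2g = 0` (`card_eq_zero_of_forall_sum_pow_eq_zero`), contradicting `g ≥ 1` (`one_le_genus_superelliptic_three`).
[cite: Stichtenoth2009, Thm. 5.2.1 and Cor. 5.1.16] [cite: Weil1948] [cite: Milne1986JacobianVarieties, §11 Prop. 11.2] -/
theorem nontrivial_tateModule_superellipticPic_of_lefschetz
    (hX3 : ∀ (k : Type) [Field k] [Fintype k] (Ω : Type) [Field Ω] [Algebra k Ω] [IsAlgClosed Ω]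
      [Algebra.IsAlgebraic k Ω] (p : ℕ) [Fact p.Prime] (ℓ : ℕ) [Fact ℓ.Prime] (f : k[X]),
      (p : k) ≠ 0 → (ℓ : k) ≠ 0 → f.Separable → ¬ p ∣ f.natDegree →
      ∀ [Fact (Irreducible (superellipticPoly k Ω p f))] (φ : Ω ≃ₐ[k] Ω), (∀ x : Ω, φ x = x ^ Fintype.card k) →
      ∀ (ξ : CyclicCoverDeck Ω p),
        LinearMap.trace ℚ_[ℓ] (RationalTateModule (SuperellipticPic k Ω p f) ℓ)
          (rationalTateRepresentation (Ω ≃ₐ[k] Ω) (SuperellipticPic k Ω p f) ℓ φ ∘ₗ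
            rationalTateRepresentation (CyclicCoverDeck Ω p) (SuperellipticPic k Ω p f) ℓ ξ) =
          (Fintype.card k : ℚ_[ℓ]) + 1 -
            Nat.card {P : PlaceOver Ω (SuperellipticFunctionField k Ω p f) // φ • (ξ • P) = P})
    {k : Type} [Field k] [Fintype k] {Ω : Type} [Field Ω] [Algebra k Ω] [IsAlgClosed Ω] [Algebra.IsAlgebraic k Ω]
    {f : k[X]} (h3 : (3 : k) ≠ 0) (hsep : f.Separable) (hdeg : f.natDegree = 4) (hq : 3 ∣ Fintype.card k - 1)
    [Fact (Irreducible (superellipticPoly k Ω 3 f))] (φ : Ω ≃ₐ[k] Ω) (hφ : ∀ x : Ω, φ x = x ^ Fintype.card k) :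
    Nontrivial (TateModule (SuperellipticPic k Ω 3 f) 3) := by
  haveI : Fact (Nat.Prime 3) := ⟨Nat.prime_three⟩
  have hndvd : ¬ 3 ∣ f.natDegree := by rw [hdeg]; decide
  have h2 : 2 ≤ f.natDegree := by rw [hdeg]; norm_num
  haveI : Fact (Irreducible (superellipticPoly k k 3 f)) := fact_irreducible_superellipticPoly k k f hsep (by rw [hdeg]; norm_num)
  by_contra hnt
  haveI : Subsingleton (TateModule (SuperellipticPic k Ω 3 f) 3) := not_nontrivial_iff_subsingleton.mp hnt
  have hN : ∀ r : ℕ, 0 < r → pointCount k (SuperellipticFunctionField k k 3 f) r = Fintype.card k ^ r + 1 :=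
    fun r hr => pointCount_eq_pow_add_one_of_subsingleton hX3 h3 hsep hdeg hq φ hφ hr
  -- Hasse–Weil for `k(C_f)`
  haveI : IsIntegrallyClosedIn k (SuperellipticFunctionField k k 3 f) :=
    isIntegrallyClosedIn_of_isRational (degree_inftyPlace hndvd)
  obtain ⟨α, hα, hcount⟩ := exists_pointCount_eq_of_facts (K := k) (F := SuperellipticFunctionField k k 3 f)
    lSeries_eq_polynomial_holds hasseWeil_holds
  have hsum0 : ∀ r : ℕ, 0 < r → ∑ i, α i ^ r = 0 := by
    intro r hr
    have h1 := hcount r hr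
    rw [hN r hr] at h1
    push_cast at h1
    linear_combination h1
  have hα0 : ∀ i, α i ≠ 0 := by
    intro i h0
    have h1 := hα i
    rw [h0, norm_zero] at h1
    have h2 : (0 : ℝ) < √(Fintype.card k : ℝ) := Real.sqrt_pos.2 (by exact_mod_cast Fintype.card_pos)
    linarith
  have hg0 := card_eq_zero_of_forall_sum_pow_eq_zero α hα0 hsum0
  -- but `g ≥ 1`
  obtain ⟨ζ₀, hζ₀⟩ := exists_isPrimitiveRoot_of_dvd_card_sub_one (K := k) (p := 3) hq
  have hg1 := one_le_genus_superelliptic_three (K := k) (L := k) (f := f) hζ₀ h3 hsep hndvd h2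
  omega

end Weil

end SuperellipticFunctionField

/-! ### The Picard curve: `T₃ J(C_f) ≠ 0`, and the full statement from `hX2` + `hX3` -/

section Picard

variable (K : Type) [Field K] [NumberField K] [IsCyclotomicExtension {3} ℚ K]
variable (f : ℤ[X]) [hf4 : Fact (f.natDegree = 4)] [hfs : Fact (f.map (Int.castRingHom ℚ)).Separable]

attribute [local instance] fact_irreducible_picard_inst picardEisensteinModule picard_isScalarTower_inst
  picard_smulCommClass_inst

variable {K f}

variable
  (hX2 : ∀ (K : Type) [Field K] [NumberField K] (p : ℕ) [Fact p.Prime] (f : K[X]) (f₀ : (𝓞 K)[X]),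
    f₀.map (algebraMap (𝓞 K) K) = f →
    ∀ (𝔭 : HeightOneSpectrum (𝓞 K)) (𝔓 : Ideal (absIntegers (𝓞 K) K)) [𝔓.IsMaximal] [𝔓.LiesOver 𝔭.asIdeal],
    (p : 𝓞 K) ∉ 𝔭.asIdeal → ¬ p ∣ f.natDegree →
    (f₀.map (Ideal.Quotient.mk 𝔭.asIdeal)).natDegree = f.natDegree →
    (f₀.map (Ideal.Quotient.mk 𝔭.asIdeal)).Separable →
    ∀ [Fact (Irreducible (superellipticPoly K (AlgebraicClosure K) p f))]
      [Fact (Irreducible (superellipticPoly (𝓞 K ⧸ 𝔭.asIdeal) (absIntegers (𝓞 K) K ⧸ 𝔓) p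
        (f₀.map (Ideal.Quotient.mk 𝔭.asIdeal))))],
    ∃ red : GeomPic K p f →+
        SuperellipticPic (𝓞 K ⧸ 𝔭.asIdeal) (absIntegers (𝓞 K) K ⧸ 𝔓) p (f₀.map (Ideal.Quotient.mk 𝔭.asIdeal)),
      (∀ (τ : MulAction.stabilizer (absoluteGaloisGroup K) 𝔓) (c : GeomPic K p f),
          red ((τ : absoluteGaloisGroup K) • c) =
            (Ideal.Quotient.stabilizerHom 𝔓 𝔭.asIdeal (absoluteGaloisGroup K) τ) • red c) ∧
      (∀ (ζ : CyclicCoverDeck (AlgebraicClosure K) p) (c : GeomPic K p f),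
          red (ζ • c) = CyclicCoverDeck.reduceMod K p 𝔓 ζ • red c) ∧
      (∀ N : ℕ, (N : 𝓞 K ⧸ 𝔭.asIdeal) ≠ 0 →
        (∀ c : GeomPic K p f, N • c = 0 → red c = 0 → c = 0) ∧
        (∀ c', N • c' = 0 → ∃ c : GeomPic K p f, N • c = 0 ∧ red c = c')))
  (hX3 : ∀ (k : Type) [Field k] [Fintype k] (Ω : Type) [Field Ω] [Algebra k Ω] [IsAlgClosed Ω]
    [Algebra.IsAlgebraic k Ω] (p : ℕ) [Fact p.Prime] (ℓ : ℕ) [Fact ℓ.Prime] (f : k[X]),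
    (p : k) ≠ 0 → (ℓ : k) ≠ 0 → f.Separable → ¬ p ∣ f.natDegree →
    ∀ [Fact (Irreducible (superellipticPoly k Ω p f))] (φ : Ω ≃ₐ[k] Ω), (∀ x : Ω, φ x = x ^ Fintype.card k) →
    ∀ (ξ : CyclicCoverDeck Ω p),
      LinearMap.trace ℚ_[ℓ] (RationalTateModule (SuperellipticPic k Ω p f) ℓ)
        (rationalTateRepresentation (Ω ≃ₐ[k] Ω) (SuperellipticPic k Ω p f) ℓ φ ∘ₗ
          rationalTateRepresentation (CyclicCoverDeck Ω p) (SuperellipticPic k Ω p f) ℓ ξ) =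
        (Fintype.card k : ℚ_[ℓ]) + 1 -
          Nat.card {P : PlaceOver Ω (SuperellipticFunctionField k Ω p f) // φ • (ξ • P) = P})

include hX2 hX3 in
/-- **`T₃ J(C_f) ≠ 0` for every Picard quartic over a number field `K ⊇ ℚ(ω)`** — the residual input `hX0` of
`picardCurve_exists_lambdaAdicRep_of_nontrivial_goodReduction_lefschetz`, now PROVED from `hX2` + `hX3`: at a
good place `𝔭 ∤ 3` (Chebotarev, `picard_exists_goodPlace_frob_smul_rootSet_eq`, merely to have one) the
reduction map of `hX2` is bijective on `3`-power torsion, hence an isomorphism of Tate modules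
(`tateModule_map_bijective_of_forall_torsionBy`), and the Tate module of the special fibre `Pic(C_{f̄, κ(𝔓)})`
is nonzero (`nontrivial_tateModule_superellipticPic_of_lefschetz`: twisted Lefschetz + Hasse–Weil).
[cite: Upton2009, §2] [cite: SerreTate1968GoodReduction, §1, Thm. 1] [cite: Stichtenoth2009, Thm. 5.2.1] -/
theorem picard_nontrivial_tateModule : Nontrivial (TateModule (GeomPic K 3 (f.map (algebraMap ℤ K))) 3) := by
  obtain ⟨𝔭, 𝔓, Φ, h3𝔭, hdeg𝔭, hsep𝔭, h𝔓, hΦ, -⟩ :=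
    picard_exists_goodPlace_frob_smul_rootSet_eq (K := K) (f := f) 1
  haveI := HeightOneSpectrum.isMaximal_of_mem_primesAbove h𝔓
  haveI : 𝔓.LiesOver 𝔭.asIdeal := h𝔓.2
  haveI : Fact (Nat.Prime 3) := ⟨Nat.prime_three⟩
  haveI := fact_irreducible_reduction_inst (K := K) (f := f) hdeg𝔭 hsep𝔭 (𝔓 := 𝔓)
  letI : Fintype (𝓞 K ⧸ 𝔭.asIdeal) := Fintype.ofFinite (𝓞 K ⧸ 𝔭.asIdeal)
  haveI : IsAlgClosed (absIntegers (𝓞 K) K ⧸ 𝔓) := absIntegers.isAlgClosed_quotient 𝔓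
  haveI : Algebra.IsAlgebraic (𝓞 K ⧸ 𝔭.asIdeal) (absIntegers (𝓞 K) K ⧸ 𝔓) := inferInstance
  have hfb' : ((f.map (algebraMap ℤ (𝓞 K))).map (Ideal.Quotient.mk 𝔭.asIdeal)) =
      f.map ((Ideal.Quotient.mk 𝔭.asIdeal).comp (algebraMap ℤ (𝓞 K))) := map_map_mk_ringOfIntegers K f 𝔭
  have h3k : (3 : (𝓞 K ⧸ 𝔭.asIdeal)) ≠ 0 := three_ne_zero_residue h3𝔭
  have hq : Fintype.card (𝓞 K ⧸ 𝔭.asIdeal) = 𝔭.residueCard := by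
    rw [HeightOneSpectrum.residueCard_eq_card_quotient, Nat.card_eq_fintype_card]
  have hdegb : ((f.map (algebraMap ℤ (𝓞 K))).map (Ideal.Quotient.mk 𝔭.asIdeal)).natDegree = 4 := by rw [hfb']; exact hdeg𝔭
  have hsepb : ((f.map (algebraMap ℤ (𝓞 K))).map (Ideal.Quotient.mk 𝔭.asIdeal)).Separable := by rw [hfb']; exact hsep𝔭
  have hpq : 3 ∣ Fintype.card (𝓞 K ⧸ 𝔭.asIdeal) - 1 := by
    rw [hq]; exact three_dvd_residueCard_sub_one (isPrimitiveRoot_zeta3Int K) h3𝔭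
  -- the reduction isomorphism of Tate modules
  obtain ⟨red, -, -, hinj, hsurj⟩ := picard_exists_reduction_bij (K := K) (f := f) hX2 h3𝔭 hdeg𝔭 hsep𝔭 (𝔓 := 𝔓)
  have hbij := tateModule_map_bijective_of_forall_torsionBy red hinj hsurj
  -- the Frobenius of `κ(𝔓)` and the special fibre
  set φ : (absIntegers (𝓞 K) K ⧸ 𝔓) ≃ₐ[(𝓞 K ⧸ 𝔭.asIdeal)] (absIntegers (𝓞 K) K ⧸ 𝔓) :=
    Ideal.Quotient.stabilizerHom 𝔓 𝔭.asIdeal (absoluteGaloisGroup K) ⟨Φ, hΦ.mem_stabilizer⟩ with hφdef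
  have hφ : ∀ x : (absIntegers (𝓞 K) K ⧸ 𝔓), φ x = x ^ Fintype.card (𝓞 K ⧸ 𝔭.asIdeal) :=
    stabilizerHom_apply_eq_pow (K := K) Φ hΦ
  haveI := nontrivial_tateModule_superellipticPic_of_lefschetz hX3 (k := 𝓞 K ⧸ 𝔭.asIdeal)
    (Ω := absIntegers (𝓞 K) K ⧸ 𝔓) (f := (f.map (algebraMap ℤ (𝓞 K))).map (Ideal.Quotient.mk 𝔭.asIdeal))
    h3k hsepb hdegb hpq φ hφ
  exact hbij.2.nontrivial

end Picard

/-- **Galois representations attached to Picard curves** (Upton 2009, Thm. 2.1 / §4) from the two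
classical inputs on Jacobians ALONE: GIVEN (`hX2`) the good-reduction datum for `y^p = f(x)` (Serre–Tate
§1 Thm. 1; Deuring) and (`hX3`) the twisted Lefschetz trace formula on `V_ℓ` of `Pic` of `y^p = f(x)` over
finite fields (Milne JV §11 Prop. 11.2; Weil), the statement `picardCurve_exists_lambdaAdicRep` holds for EVERY
quartic `f ∈ ℤ[X]` separable over `ℚ` — existence of `ρ : Γ_{ℚ(ω)} → GL₃(ℚ̄₃)` unramified outside `3N` with
`tr ρ(Frob_𝔭⁻¹) = j(a_𝔭(f))`, and absolute irreducibility when `12 ∣ #Gal(f/ℚ)`.  The torsion/divisibility/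
non-vanishing input on `T₃ J(C_f)` of the earlier conditional theorems (`hX1`, `hX1'`, `hcard`, `hX0`: forms of
`dim J(C_f) = 3`) is replaced by the Hasse–Weil theorem for function fields, which is proved in the tree
(`picard_nontrivial_tateModule`).
[cite: Upton2009, Thm. 2.1 and §4] [cite: SerreTate1968GoodReduction, §1, Thm. 1]
[cite: Milne1986JacobianVarieties, §11 Prop. 11.2] [cite: Stichtenoth2009, Thm. 5.2.1] [cite: Weil1948] -/
theorem picardCurve_exists_lambdaAdicRep_of_goodReduction_lefschetz
    (hX2 : ∀ (K : Type) [Field K] [NumberField K] (p : ℕ) [Fact p.Prime] (f : K[X]) (f₀ : (𝓞 K)[X]),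
      f₀.map (algebraMap (𝓞 K) K) = f →
      ∀ (𝔭 : HeightOneSpectrum (𝓞 K)) (𝔓 : Ideal (absIntegers (𝓞 K) K)) [𝔓.IsMaximal] [𝔓.LiesOver 𝔭.asIdeal],
      (p : 𝓞 K) ∉ 𝔭.asIdeal → ¬ p ∣ f.natDegree →
      (f₀.map (Ideal.Quotient.mk 𝔭.asIdeal)).natDegree = f.natDegree →
      (f₀.map (Ideal.Quotient.mk 𝔭.asIdeal)).Separable →
      ∀ [Fact (Irreducible (superellipticPoly K (AlgebraicClosure K) p f))]
        [Fact (Irreducible (superellipticPoly (𝓞 K ⧸ 𝔭.asIdeal) (absIntegers (𝓞 K) K ⧸ 𝔓) p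
          (f₀.map (Ideal.Quotient.mk 𝔭.asIdeal))))],
      ∃ red : GeomPic K p f →+
          SuperellipticPic (𝓞 K ⧸ 𝔭.asIdeal) (absIntegers (𝓞 K) K ⧸ 𝔓) p (f₀.map (Ideal.Quotient.mk 𝔭.asIdeal)),
        (∀ (τ : MulAction.stabilizer (absoluteGaloisGroup K) 𝔓) (c : GeomPic K p f),
            red ((τ : absoluteGaloisGroup K) • c) =
              (Ideal.Quotient.stabilizerHom 𝔓 𝔭.asIdeal (absoluteGaloisGroup K) τ) • red c) ∧
        (∀ (ζ : CyclicCoverDeck (AlgebraicClosure K) p) (c : GeomPic K p f),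
            red (ζ • c) = CyclicCoverDeck.reduceMod K p 𝔓 ζ • red c) ∧
        (∀ N : ℕ, (N : 𝓞 K ⧸ 𝔭.asIdeal) ≠ 0 →
          (∀ c : GeomPic K p f, N • c = 0 → red c = 0 → c = 0) ∧
          (∀ c', N • c' = 0 → ∃ c : GeomPic K p f, N • c = 0 ∧ red c = c')))
    (hX3 : ∀ (k : Type) [Field k] [Fintype k] (Ω : Type) [Field Ω] [Algebra k Ω] [IsAlgClosed Ω]
      [Algebra.IsAlgebraic k Ω] (p : ℕ) [Fact p.Prime] (ℓ : ℕ) [Fact ℓ.Prime] (f : k[X]),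
      (p : k) ≠ 0 → (ℓ : k) ≠ 0 → f.Separable → ¬ p ∣ f.natDegree →
      ∀ [Fact (Irreducible (superellipticPoly k Ω p f))] (φ : Ω ≃ₐ[k] Ω), (∀ x : Ω, φ x = x ^ Fintype.card k) →
      ∀ (ξ : CyclicCoverDeck Ω p),
        LinearMap.trace ℚ_[ℓ] (RationalTateModule (SuperellipticPic k Ω p f) ℓ)
          (rationalTateRepresentation (Ω ≃ₐ[k] Ω) (SuperellipticPic k Ω p f) ℓ φ ∘ₗ
            rationalTateRepresentation (CyclicCoverDeck Ω p) (SuperellipticPic k Ω p f) ℓ ξ) =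
          (Fintype.card k : ℚ_[ℓ]) + 1 -
            Nat.card {P : PlaceOver Ω (SuperellipticFunctionField k Ω p f) // φ • (ξ • P) = P}) :
    picardCurve_exists_lambdaAdicRep :=
  picardCurve_exists_lambdaAdicRep_of_nontrivial_goodReduction_lefschetz
    (fun K _ _ _ f h4 hsep => by
      haveI : Fact (f.natDegree = 4) := ⟨h4⟩
      haveI : Fact (f.map (Int.castRingHom ℚ)).Separable := ⟨hsep⟩
      exact picard_nontrivial_tateModule (K := K) (f := f) hX2 hX3)
    hX2 hX3


end Literature.NumberTheory.GaloisRepresentations
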